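import Summits.QuantumFields.YangMills.Theorems.BalabanUVNodesN15VectorPieceEntries
import HarnessLib

/-!
# Route «BalabanUVNodes» (K4 «SpineRates»), node N15 = NE2, -a lane, part 16: ENTRIES 1–2 OF THE VECTOR SINGLE-SCALE PIECE WITH UNIFORM MAJORANTS
# `B·(L^k)^{−min(α,γ)∕2}·e^{−ρ|y−y′|_T}`, and ONE SET OF CONSTANTS for the three proved entries over all directions

Cell `pub-ymgap`, seat `pub-ymgap-dag-n15-a` (KNIT-BY-NAME, generation g4; HUMAN RULING D-0062; chair R424 venue; `bears_on: R4∕N15`).  Filed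
`--supports stmt-QuantumFields-19351` (helper).  THEOREMS + one constant (`rateDConst`); imports part 15 (`entry0∕1∕2`, `hasMaj_entry0`, the plumbing) and
through it parts 10∕14 and n15-b's `OperatorReadout` BY NAME; nothing in the tree modified.

WHAT IS DONE.  Part 14's derivative entries carry the paired rate of `∂_νH_k` in the form `R_D = √(ρ_D(L^k)·2M_D·periodConst)`,
`ρ_D(n) = 2^{1−α}((d+1)∕n)^α·A₀ + T163(d+1,0,γ)·n^{−γ}` (part 11, interpolation at `θ = ½`).  §1 `rateD_le`: for `L ≥ 1`, `0 ≤ α < 1`, `0 < γ < 1`,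
`R_D ≤ rateDConst(d,α,γ)·(L^k)^{−min(α,γ)∕2}` (`x^{−α}, x^{−γ} ≤ x^{−min(α,γ)}` at `x = L^k ≥ 1`, `(·)^{1∕2}` monotone; King's alias constant `C(d+1,α) ≥ 0` from
`King1986.alias_sum_le_of_subset`).  §2 `shape1_le`∕`shape2_le` (the two majorant shapes are monotone and homogeneous in their three rate slots),
**`hasMaj_entry1`**, **`hasMaj_entry2`**: `∃ B, δ₁ > 0` uniform in the volume, `k` and `m` with `HasMaj … (B·(L^k)^{−min(α,γ)∕2}·e^{−ρ|y−y′|_T})`, `0 ≤ ρ ≤ δ₁`.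
§3 `exists_forall_fin_of_forall_exists` (finite uniformisation over the `d + 1` directions), **`hasMaj_threeEntries`**: ONE `(B, δ₀)` for `entry0`, `entry1 ν`,
`entry2 ν`, all tori `L ∣ M_ν`, all `k`, `m ≥ 1`, all `ν` — the unconditional content the readout (part 17) consumes.

HONEST FRAMING ∕ LIMITS.  As part 15: `U = 1` linear theory on finite tori, one single-scale piece in King's (4.42) shape; the rate exponent `min(α,γ)∕2 < ½`
of the derivative entries is part 11's interpolation loss (no optimality claimed); NE2⁺ NOT PRINTED ∕ not proved; the fourth entry is NOT here; count-neutral;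
NOT a discharge of N15; one finite T⁴ at fixed ε — NOT infinite volume, NOT OS on ℝ⁴, NOT a mass gap, NOT Clay.
-/

noncomputable section

open scoped BigOperators
open Finset

namespace Summit.QuantumFields.YangMills.BalabanUVNodes.N15.VectorPiece

open Literature.MathematicalPhysics.QuantumFieldTheory.Balaban1983to89
open Literature.MathematicalPhysics.QuantumFieldTheory.Balaban1983to89.B11SectG (BlockNorm HasMaj)
open Literature.MathematicalPhysics.QuantumFieldTheory.Balaban1983to89.T4EtaRate (PairedInstance EtaPairing EtaRateIneq342 NE2PlusOperator
  NE2ZeroOperator rateFactor)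
open Literature.MathematicalPhysics.QuantumFieldTheory.Balaban1983to89.T4EtaRateDefect (idef rateWeight)
open Literature.MathematicalPhysics.QuantumFieldTheory.Balaban1983to89.T4EtaRateDefectSite (pt9Bg)
open Literature.MathematicalPhysics.QuantumFieldTheory.Balaban1983to89.T4EtaRateCoeffDefect (pull)
open Literature.MathematicalPhysics.QuantumFieldTheory.Balaban1983to89.B4TorusKernel (periodConst)
open Literature.MathematicalPhysics.QuantumFieldTheory.Balaban1983to89.B5Prop11Plancherel (Tor fine fdiff)
open Literature.MathematicalPhysics.QuantumFieldTheory.Balaban1983to89.B5Hk163Strip (kappa163 kappa163_pos)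
open Literature.MathematicalPhysics.QuantumFieldTheory.Balaban1983to89.B5Hk163Decay (MG163)
open Literature.MathematicalPhysics.QuantumFieldTheory.Balaban1983to89.B5Hk163Torus (HkOp)
open Literature.MathematicalPhysics.QuantumFieldTheory.Balaban1983to89.B5Hk163TorusHolderDecay (MD163)
open Literature.MathematicalPhysics.QuantumFieldTheory.Balaban1983to89.B5Hk163RateSum (C0maj C1maj T163)
open Literature.MathematicalPhysics.QuantumFieldTheory.Balaban1983to89.T4Hk163StripRate (CGe)
open Literature.MathematicalPhysics.QuantumFieldTheory.Balaban1983to89.B6LowerBound2153Torus (rep rep_mem_pbox)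
open Literature.MathematicalPhysics.QuantumFieldTheory.Balaban1983to89.B6Lemma24Torus (pbox)
open Literature.MathematicalPhysics.QuantumFieldTheory.Balaban1983to89.B6Cov2156Torus (deltaPol bondReductionT)
open Literature.MathematicalPhysics.QuantumFieldTheory.Balaban1983to89.B6UnitTorusCarrier (unitTorusGeo unitTorusGeo_len)
open Literature.MathematicalPhysics.QuantumFieldTheory.King1986 (aliasConst)
open Literature.MathematicalPhysics.QuantumFieldTheory.King1986.Torus (tdistT tdistT_nonneg)
open Summit.QuantumFields.YangMills.BalabanUVNodes.N15.OperatorReadout (opGeo opFamily opGeo_len rateFactor_opGeo etaRateIneq342_of_hasMaj)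
open Summit.QuantumFields.YangMills.BalabanUVNodes.N15.DefectKernel (hasMaj_idef_vectorPiece_unitTorus hasMaj_idef_vectorPieceDeriv_unitTorus
  hasMaj_idef_vectorPieceAdjDeriv_unitTorus)

variable {d : ℕ}

/-! ## §1 The derivative rate `R_D` is `O((L^k)^{−min(α,γ)∕2})` -/

section Majorants

variable {L : ℕ} [NeZero L]

/-- King's alias constant `C(d+1, α)` of (4.22) is nonnegative (the empty sub-sum). [cite: King1986, (4.22) p.672] -/
theorem aliasConst_nonneg' (d : ℕ) {α : ℝ} (hα : α < 1) : 0 ≤ aliasConst (d + 1) α := by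
  have h := Literature.MathematicalPhysics.QuantumFieldTheory.King1986.alias_sum_le_of_subset (Nat.succ_pos d) hα
    (p := fun _ : Fin (d + 1) => (0 : ℝ))
    (fun _ => by rw [abs_zero]; exact Real.pi_pos.le) (Λ := ∅) (by simp)
  simpa using h

/-- The constant in front of `(L^k)^{−min(α,γ)∕2}` bounding the derivative kernel's paired rate `R_D` (part 11's `√(ρ_D·2M_D·periodConst)`).
[cite: King1986, Prop. 3.8 (3.71) p.664 (second line, shape)] -/
def rateDConst (d : ℕ) (α γ : ℝ) : ℝ :=
  (2 ^ (1 - α) * ((d + 1 : ℕ) : ℝ) ^ α * (C0maj (d + 1) * (Real.pi * Real.pi ^ α) + C1maj (d + 1) * aliasConst (d + 1) α)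
      + |T163 (d + 1) 0 γ|) ^ (1 / 2 : ℝ) *
    (2 * (MD163 (d + 1) * periodConst (kappa163 (d + 1)) d)) ^ (1 / 2 : ℝ)

/-- The Hölder-side constant `A₀ = C0maj·π^{1+α} + C1maj·C(d+1, α)` is nonnegative. [folklore] -/
theorem holderSide_nonneg (d : ℕ) {α : ℝ} (hα1 : α < 1) :
    0 ≤ C0maj (d + 1) * (Real.pi * Real.pi ^ α) + C1maj (d + 1) * aliasConst (d + 1) α :=
  add_nonneg (mul_nonneg (B5Hk163RateSum.C0maj_nonneg _) (by positivity))
    (mul_nonneg (B5Hk163RateSum.C1maj_nonneg _) (aliasConst_nonneg' d hα1))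

/-- `0 ≤ rateDConst` (`α < 1`). [folklore] -/
theorem rateDConst_nonneg (d : ℕ) {α : ℝ} (hα1 : α < 1) (γ : ℝ) : 0 ≤ rateDConst d α γ := by
  have hA := holderSide_nonneg d hα1
  have hC : 0 ≤ MD163 (d + 1) * periodConst (kappa163 (d + 1)) d := B5Hk163TorusHolderDecay.CdecD_nonneg
  unfold rateDConst
  exact mul_nonneg (Real.rpow_nonneg (by positivity) _) (Real.rpow_nonneg (by positivity) _)

/-- **THE DERIVATIVE RATE IS `O((L^k)^{−min(α,γ)∕2})`**: part 11's paired rate `R_D = √(ρ_D(L^k)·2M_D·periodConst)` is at most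
`rateDConst·(L^k)^{−min(α,γ)∕2}` (`L ≥ 1`, `0 ≤ α < 1`, `0 < γ < 1`). [cite: King1986, Prop. 3.8 (3.71) p.664 (second line, shape)] -/
theorem rateD_le (hL : 1 ≤ L) (k : ℕ) {α γ : ℝ} (hα0 : 0 ≤ α) (hα1 : α < 1) (hγ0 : 0 < γ) (hγ1 : γ < 1) :
    (2 ^ (1 - α) * (((d + 1 : ℕ) : ℝ) / ((L : ℝ) ^ k)) ^ α * (C0maj (d + 1) * (Real.pi * Real.pi ^ α) + C1maj (d + 1) * aliasConst (d + 1) α)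
          + T163 (d + 1) 0 γ / ((L : ℝ) ^ k) ^ γ) ^ (1 / 2 : ℝ)
        * (2 * (MD163 (d + 1) * periodConst (kappa163 (d + 1)) d)) ^ (1 / 2 : ℝ)
      ≤ rateDConst d α γ * ((L : ℝ) ^ k) ^ (-(min α γ / 2)) := by
  have hx1 : (1 : ℝ) ≤ (L : ℝ) ^ k := one_le_pow₀ (by exact_mod_cast hL)
  have hx0 : (0 : ℝ) < (L : ℝ) ^ k := lt_of_lt_of_le one_pos hx1
  have hcast : ((L ^ k : ℕ) : ℝ) = (L : ℝ) ^ k := by push_cast; ring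
  have hρD0 : 0 ≤ 2 ^ (1 - α) * (((d + 1 : ℕ) : ℝ) / ((L : ℝ) ^ k)) ^ α
        * (C0maj (d + 1) * (Real.pi * Real.pi ^ α) + C1maj (d + 1) * aliasConst (d + 1) α) + T163 (d + 1) 0 γ / ((L : ℝ) ^ k) ^ γ := by
    have h := Summit.QuantumFields.YangMills.BalabanUVNodes.N15.DefectKernel.rateD_nonneg (d := d) (L ^ k) hα0 hα1 hγ0 hγ1 0 0 0
    rw [hcast] at h
    exact h
  set x : ℝ := (L : ℝ) ^ k with hxdef
  set A₀ : ℝ := C0maj (d + 1) * (Real.pi * Real.pi ^ α) + C1maj (d + 1) * aliasConst (d + 1) α with hA₀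
  have hA₀0 : 0 ≤ A₀ := holderSide_nonneg d hα1
  have hA₁0 : 0 ≤ 2 ^ (1 - α) * ((d + 1 : ℕ) : ℝ) ^ α * A₀ + |T163 (d + 1) 0 γ| := by positivity
  have hC : 0 ≤ MD163 (d + 1) * periodConst (kappa163 (d + 1)) d := B5Hk163TorusHolderDecay.CdecD_nonneg
  -- the two rate terms are `O(x^{−μ})`, `μ = min α γ`
  have hxa : x ^ (-α) ≤ x ^ (-min α γ) := Real.rpow_le_rpow_of_exponent_le hx1 (neg_le_neg (min_le_left _ _))
  have hxg : x ^ (-γ) ≤ x ^ (-min α γ) := Real.rpow_le_rpow_of_exponent_le hx1 (neg_le_neg (min_le_right _ _))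
  have h1 : (((d + 1 : ℕ) : ℝ) / x) ^ α = ((d + 1 : ℕ) : ℝ) ^ α * x ^ (-α) := by
    rw [Real.div_rpow (by positivity) hx0.le, Real.rpow_neg hx0.le, div_eq_mul_inv]
  have hρD : 2 ^ (1 - α) * (((d + 1 : ℕ) : ℝ) / x) ^ α * A₀ + T163 (d + 1) 0 γ / x ^ γ
      ≤ (2 ^ (1 - α) * ((d + 1 : ℕ) : ℝ) ^ α * A₀ + |T163 (d + 1) 0 γ|) * x ^ (-min α γ) := by
    rw [h1, add_mul]
    apply add_le_add
    · have : 2 ^ (1 - α) * (((d + 1 : ℕ) : ℝ) ^ α * x ^ (-α)) * A₀ = (2 ^ (1 - α) * ((d + 1 : ℕ) : ℝ) ^ α * A₀) * x ^ (-α) := by ring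
      rw [this]
      exact mul_le_mul_of_nonneg_left hxa (by positivity)
    · rw [div_eq_mul_inv, ← Real.rpow_neg hx0.le]
      exact (mul_le_mul_of_nonneg_right (le_abs_self _) (Real.rpow_nonneg hx0.le _)).trans
        (mul_le_mul_of_nonneg_left hxg (abs_nonneg _))
  have hsq : (2 ^ (1 - α) * (((d + 1 : ℕ) : ℝ) / x) ^ α * A₀ + T163 (d + 1) 0 γ / x ^ γ) ^ (1 / 2 : ℝ)
      ≤ (2 ^ (1 - α) * ((d + 1 : ℕ) : ℝ) ^ α * A₀ + |T163 (d + 1) 0 γ|) ^ (1 / 2 : ℝ) * x ^ (-(min α γ / 2)) := by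
    refine (Real.rpow_le_rpow hρD0 hρD (by norm_num)).trans (le_of_eq ?_)
    rw [Real.mul_rpow hA₁0 (Real.rpow_nonneg hx0.le _), ← Real.rpow_mul hx0.le]
    congr 2
    ring
  calc _ ≤ ((2 ^ (1 - α) * ((d + 1 : ℕ) : ℝ) ^ α * A₀ + |T163 (d + 1) 0 γ|) ^ (1 / 2 : ℝ) * x ^ (-(min α γ / 2)))
        * (2 * (MD163 (d + 1) * periodConst (kappa163 (d + 1)) d)) ^ (1 / 2 : ℝ) :=
        mul_le_mul_of_nonneg_right hsq (Real.rpow_nonneg (by positivity) _)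
    _ = rateDConst d α γ * x ^ (-(min α γ / 2)) := by rw [rateDConst]; ring

/-! ## §2 Entries 1 and 2 with uniform majorants -/

omit [NeZero L] in
/-- Monotonicity of part 14 §1's majorant shape in its three rate slots (all other letters nonnegative). [folklore] -/
theorem shape1_le {d1 cD cr B₀ c₀ S₁ S₂ S₃ K₁ K₂ K₃ t : ℝ} (hd1 : 0 ≤ d1) (hcD : 0 ≤ cD) (hcr : 0 ≤ cr) (hB₀ : 0 ≤ B₀)
    (hc₀ : 0 ≤ c₀) (h₁ : S₁ ≤ K₁ * t) (h₂ : S₂ ≤ K₂ * t) (h₃ : S₃ ≤ K₃ * t) :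
    d1 * cD * cr * (d1 * B₀ * cr * (d1 * S₁) + d1 * S₂ * cr * (d1 * c₀)) + d1 * S₃ * cr * (d1 * B₀ * cr * (d1 * c₀))
      ≤ (d1 * cD * cr * (d1 * B₀ * cr * (d1 * K₁) + d1 * K₂ * cr * (d1 * c₀)) + d1 * K₃ * cr * (d1 * B₀ * cr * (d1 * c₀))) * t := by
  calc d1 * cD * cr * (d1 * B₀ * cr * (d1 * S₁) + d1 * S₂ * cr * (d1 * c₀)) + d1 * S₃ * cr * (d1 * B₀ * cr * (d1 * c₀))
      ≤ d1 * cD * cr * (d1 * B₀ * cr * (d1 * (K₁ * t)) + d1 * (K₂ * t) * cr * (d1 * c₀)) + d1 * (K₃ * t) * cr * (d1 * B₀ * cr * (d1 * c₀)) := by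
        gcongr
    _ = _ := by ring

omit [NeZero L] in
/-- Monotonicity of part 14 §2's majorant shape in its three rate slots. [folklore] -/
theorem shape2_le {d1 cD cr B₀ c₀ S₁ S₂ S₃ K₁ K₂ K₃ t : ℝ} (hd1 : 0 ≤ d1) (hcD : 0 ≤ cD) (hcr : 0 ≤ cr) (hB₀ : 0 ≤ B₀)
    (hc₀ : 0 ≤ c₀) (h₁ : S₁ ≤ K₁ * t) (h₂ : S₂ ≤ K₂ * t) (h₃ : S₃ ≤ K₃ * t) :
    d1 * c₀ * cr * (d1 * B₀ * cr * (d1 * S₃) + d1 * S₂ * cr * (d1 * cD)) + d1 * S₁ * cr * (d1 * B₀ * cr * (d1 * cD))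
      ≤ (d1 * c₀ * cr * (d1 * B₀ * cr * (d1 * K₃) + d1 * K₂ * cr * (d1 * cD)) + d1 * K₁ * cr * (d1 * B₀ * cr * (d1 * cD))) * t := by
  calc d1 * c₀ * cr * (d1 * B₀ * cr * (d1 * S₃) + d1 * S₂ * cr * (d1 * cD)) + d1 * S₁ * cr * (d1 * B₀ * cr * (d1 * cD))
      ≤ d1 * c₀ * cr * (d1 * B₀ * cr * (d1 * (K₃ * t)) + d1 * (K₂ * t) * cr * (d1 * cD)) + d1 * (K₁ * t) * cr * (d1 * B₀ * cr * (d1 * cD)) := by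
        gcongr
    _ = _ := by ring

/-- **ENTRY 1 WITH A UNIFORM MAJORANT** (part 14 §1 `hasMaj_idef_vectorPieceDeriv_unitTorus` at the Riemann weight, rates collected with `rateD_le`):
`∃ B, δ₁ > 0` such that for every `L ∣ M_ν`, `k`, `m ≥ 1`, `0 ≤ ρ ≤ δ₁`: `𝔇(∂′_νG′, ∂_νG)` has the block majorant `B·(L^k)^{−min(α,γ)∕2}·e^{−ρ|y−y′|_T}`.
[cite: King1986, (4.42)–(4.43) p.675, Prop. 3.8 (3.71) p.664 (second line); Balaban1984PropagatorsI, (1.63) p.28; Balaban1984PropagatorsII, (2.156) p.250] -/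
theorem hasMaj_entry1 (hd : 1 ≤ d) (hL : 1 ≤ L) {α γ : ℝ} (hα0 : 0 ≤ α) (hα1 : α < 1) (hγ0 : 0 < γ) (hγ1 : γ < 1) (ν : Fin (d + 1)) :
    ∃ B δ₁ : ℝ, 0 < B ∧ 0 < δ₁ ∧ ∀ (M : Fin (d + 1) → ℕ) [∀ μ, NeZero (M μ)] (_ : ∀ i, L ∣ M i) (k m : ℕ) (_ : 1 ≤ m)
      {ρ : ℝ} (_ : 0 ≤ ρ) (_ : ρ ≤ δ₁),
      HasMaj (BlockNorm.ofBlocks (unitTorusGeo L k M) (blkFine L k M))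
        (BlockNorm.ofBlocks (unitTorusGeo L k M) (blkFine L k M ∘ kingPrV L k m M))
        (entry1 (d := d) L k m M ν) (fun y y' => B * ((L : ℝ) ^ k) ^ (-(min α γ / 2)) * Real.exp (-(ρ * tdistT M y y'))) := by
  obtain ⟨B₀, C₁, δ', hB₀, hC₁, hδ', HP⟩ := hasMaj_idef_vectorPieceDeriv_unitTorus (d := d) hd hL hα0 hα1 hγ0 hγ1 ν
  have hL0 : L ≠ 0 := by omega
  have hpC0 : 0 ≤ periodConst (kappa163 (d + 1)) d := (B5Kernel166Decay.periodConst_pos (kappa163_pos _) d).le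
  have hMG : 0 ≤ MG163 (d + 1) := B5Hk163Decay.MG163_nonneg _
  have hσ : 0 < min (kappa163 (d + 1) / (d + 1) / 2) δ' / 2 :=
    half_pos (lt_min (half_pos (div_pos (kappa163_pos _) (by positivity))) hδ')
  have hcr0 : 0 ≤ B4Sect5Proof.latticeConst (d + 1) (min (kappa163 (d + 1) / (d + 1) / 2) δ' / 2) :=
    B4Sect5Proof.latticeConst_nonneg (d + 1) hσ.le
  have hcD : 0 ≤ MD163 (d + 1) * periodConst (kappa163 (d + 1)) d := B5Hk163TorusHolderDecay.CdecD_nonneg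
  have hMD : 0 ≤ MD163 (d + 1) := (mul_nonneg_iff_of_pos_right (B5Kernel166Decay.periodConst_pos (kappa163_pos _) d)).mp hcD
  have hCGe : 0 ≤ CGe (d + 1) := T4Hk163StripRate.CGe_nonneg _
  have hKD := rateDConst_nonneg d hα1 γ
  have hγ₀1 : min α γ / 2 ≤ 1 := by
    have := min_le_left α γ; linarith
  refine ⟨((d + 1 : ℕ) : ℝ) * (MD163 (d + 1) * periodConst (kappa163 (d + 1)) d) *
        B4Sect5Proof.latticeConst (d + 1) (min (kappa163 (d + 1) / (d + 1) / 2) δ' / 2) *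
        (((d + 1 : ℕ) : ℝ) * B₀ * B4Sect5Proof.latticeConst (d + 1) (min (kappa163 (d + 1) / (d + 1) / 2) δ' / 2) *
            (((d + 1 : ℕ) : ℝ) * ((CGe (d + 1) + (d + 1) * MD163 (d + 1)) * periodConst (kappa163 (d + 1)) d))
          + ((d + 1 : ℕ) : ℝ) * C₁ * B4Sect5Proof.latticeConst (d + 1) (min (kappa163 (d + 1) / (d + 1) / 2) δ' / 2) *
            (((d + 1 : ℕ) : ℝ) * (MG163 (d + 1) * periodConst (kappa163 (d + 1)) d)))
      + ((d + 1 : ℕ) : ℝ) * rateDConst d α γ *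
        B4Sect5Proof.latticeConst (d + 1) (min (kappa163 (d + 1) / (d + 1) / 2) δ' / 2) *
        (((d + 1 : ℕ) : ℝ) * B₀ * B4Sect5Proof.latticeConst (d + 1) (min (kappa163 (d + 1) / (d + 1) / 2) δ' / 2) *
          (((d + 1 : ℕ) : ℝ) * (MG163 (d + 1) * periodConst (kappa163 (d + 1)) d))) + 1,
    min (kappa163 (d + 1) / (d + 1) / 2) δ' / 2, by positivity, hσ, ?_⟩
  intro M _ hLM k m hm ρ hρ hρ1
  have key := HP M hLM k m hm (kingPr L k m M) (kingPr_val L k m M) (kingPrV L k m M) (fun _ => rfl)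
    (reH M (L ^ k)) (reH_single M (L ^ k)) (reH M (L ^ m * L ^ k)) (reH_single M (L ^ m * L ^ k))
    (reD M (L ^ k) ν) (reD_single M (L ^ k) ν) (reD M (L ^ m * L ^ k) ν) (reD_single M (L ^ m * L ^ k) ν)
    (rweight_nonneg (d := d) L k)
    (wTranspose M (L ^ k) (rweight (d := d) L k) (reH M (L ^ k))) (wTranspose_single M (L ^ k) (rweight (d := d) L k) (reH M (L ^ k)))
    (wTranspose M (L ^ m * L ^ k) (rweight (d := d) L k / ((L : ℝ) ^ m) ^ (d + 1)) (reH M (L ^ m * L ^ k)))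
    (wTranspose_single M (L ^ m * L ^ k) (rweight (d := d) L k / ((L : ℝ) ^ m) ^ (d + 1)) (reH M (L ^ m * L ^ k)))
    (covC L M (L ^ k)) (covC_single L M (L ^ k)) (covC L M (L ^ (k + m))) (covC_single L M (L ^ (k + m))) hρ hρ1
  refine key.mono fun y y' => ?_
  have hbal := card_mul_rweight (d := d) hL0 k
  have hcast : ((L ^ k : ℕ) : ℝ) = (L : ℝ) ^ k := by push_cast; ring
  rw [hbal, hcast]
  have hE : 0 ≤ Real.exp (-(ρ * tdistT M y y')) := Real.exp_nonneg _
  refine mul_le_mul_of_nonneg_right ?_ hE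
  have ht : 0 < ((L : ℝ) ^ k) ^ (-(min α γ / 2)) := Real.rpow_pos_of_pos (pow_pos (by exact_mod_cast (show 0 < L by omega)) _) _
  have hinv : ((L : ℝ) ^ k)⁻¹ ≤ ((L : ℝ) ^ k) ^ (-(min α γ / 2)) := inv_pow_le_rpow hL k hγ₀1
  have h₁ : (CGe (d + 1) + (d + 1) * MD163 (d + 1)) * periodConst (kappa163 (d + 1)) d / (L : ℝ) ^ k
      ≤ (CGe (d + 1) + (d + 1) * MD163 (d + 1)) * periodConst (kappa163 (d + 1)) d * ((L : ℝ) ^ k) ^ (-(min α γ / 2)) := by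
    rw [div_eq_mul_inv]
    exact mul_le_mul_of_nonneg_left hinv (by positivity)
  have h₂ : C₁ * ((L : ℝ) ^ k)⁻¹ ≤ C₁ * ((L : ℝ) ^ k) ^ (-(min α γ / 2)) := mul_le_mul_of_nonneg_left hinv hC₁.le
  have h₃ := rateD_le (d := d) hL k hα0 hα1 hγ0 hγ1
  exact (shape1_le (by positivity) hcD hcr0 hB₀.le (by positivity) h₁ h₂ h₃).trans
    (mul_le_mul_of_nonneg_right (le_add_of_nonneg_right zero_le_one) ht.le)

/-- **ENTRY 2 WITH A UNIFORM MAJORANT** (part 14 §2 `hasMaj_idef_vectorPieceAdjDeriv_unitTorus` at the Riemann weight): `𝔇(G′∂′_ν*, G∂_ν*)` has the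
block majorant `B·(L^k)^{−min(α,γ)∕2}·e^{−ρ|y−y′|_T}` uniformly in the volume, `k` and `m`.
[cite: King1986, (4.42)–(4.43) p.675, Prop. 3.8 (3.71) p.664 (second line); Balaban1984PropagatorsI, (1.63) p.28; Balaban1984PropagatorsII, (2.156) p.250] -/
theorem hasMaj_entry2 (hd : 1 ≤ d) (hL : 1 ≤ L) {α γ : ℝ} (hα0 : 0 ≤ α) (hα1 : α < 1) (hγ0 : 0 < γ) (hγ1 : γ < 1) (ν : Fin (d + 1)) :
    ∃ B δ₁ : ℝ, 0 < B ∧ 0 < δ₁ ∧ ∀ (M : Fin (d + 1) → ℕ) [∀ μ, NeZero (M μ)] (_ : ∀ i, L ∣ M i) (k m : ℕ) (_ : 1 ≤ m)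
      {ρ : ℝ} (_ : 0 ≤ ρ) (_ : ρ ≤ δ₁),
      HasMaj (BlockNorm.ofBlocks (unitTorusGeo L k M) (blkFine L k M))
        (BlockNorm.ofBlocks (unitTorusGeo L k M) (blkFine L k M ∘ kingPrV L k m M))
        (entry2 (d := d) L k m M ν) (fun y y' => B * ((L : ℝ) ^ k) ^ (-(min α γ / 2)) * Real.exp (-(ρ * tdistT M y y'))) := by
  obtain ⟨B₀, C₁, δ', hB₀, hC₁, hδ', HP⟩ := hasMaj_idef_vectorPieceAdjDeriv_unitTorus (d := d) hd hL hα0 hα1 hγ0 hγ1 ν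
  have hL0 : L ≠ 0 := by omega
  have hpC0 : 0 ≤ periodConst (kappa163 (d + 1)) d := (B5Kernel166Decay.periodConst_pos (kappa163_pos _) d).le
  have hMG : 0 ≤ MG163 (d + 1) := B5Hk163Decay.MG163_nonneg _
  have hσ : 0 < min (kappa163 (d + 1) / (d + 1) / 2) δ' / 2 :=
    half_pos (lt_min (half_pos (div_pos (kappa163_pos _) (by positivity))) hδ')
  have hcr0 : 0 ≤ B4Sect5Proof.latticeConst (d + 1) (min (kappa163 (d + 1) / (d + 1) / 2) δ' / 2) :=
    B4Sect5Proof.latticeConst_nonneg (d + 1) hσ.le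
  have hcD : 0 ≤ MD163 (d + 1) * periodConst (kappa163 (d + 1)) d := B5Hk163TorusHolderDecay.CdecD_nonneg
  have hMD : 0 ≤ MD163 (d + 1) := (mul_nonneg_iff_of_pos_right (B5Kernel166Decay.periodConst_pos (kappa163_pos _) d)).mp hcD
  have hCGe : 0 ≤ CGe (d + 1) := T4Hk163StripRate.CGe_nonneg _
  have hKD := rateDConst_nonneg d hα1 γ
  have hγ₀1 : min α γ / 2 ≤ 1 := by
    have := min_le_left α γ; linarith
  refine ⟨((d + 1 : ℕ) : ℝ) * (MG163 (d + 1) * periodConst (kappa163 (d + 1)) d) *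
        B4Sect5Proof.latticeConst (d + 1) (min (kappa163 (d + 1) / (d + 1) / 2) δ' / 2) *
        (((d + 1 : ℕ) : ℝ) * B₀ * B4Sect5Proof.latticeConst (d + 1) (min (kappa163 (d + 1) / (d + 1) / 2) δ' / 2) *
            (((d + 1 : ℕ) : ℝ) * rateDConst d α γ)
          + ((d + 1 : ℕ) : ℝ) * C₁ * B4Sect5Proof.latticeConst (d + 1) (min (kappa163 (d + 1) / (d + 1) / 2) δ' / 2) *
            (((d + 1 : ℕ) : ℝ) * (MD163 (d + 1) * periodConst (kappa163 (d + 1)) d)))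
      + ((d + 1 : ℕ) : ℝ) * ((CGe (d + 1) + (d + 1) * MD163 (d + 1)) * periodConst (kappa163 (d + 1)) d) *
        B4Sect5Proof.latticeConst (d + 1) (min (kappa163 (d + 1) / (d + 1) / 2) δ' / 2) *
        (((d + 1 : ℕ) : ℝ) * B₀ * B4Sect5Proof.latticeConst (d + 1) (min (kappa163 (d + 1) / (d + 1) / 2) δ' / 2) *
          (((d + 1 : ℕ) : ℝ) * (MD163 (d + 1) * periodConst (kappa163 (d + 1)) d))) + 1,
    min (kappa163 (d + 1) / (d + 1) / 2) δ' / 2, by positivity, hσ, ?_⟩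
  intro M _ hLM k m hm ρ hρ hρ1
  have key := HP M hLM k m hm (kingPr L k m M) (kingPr_val L k m M) (kingPrV L k m M) (fun _ => rfl)
    (reH M (L ^ k)) (reH_single M (L ^ k)) (reH M (L ^ m * L ^ k)) (reH_single M (L ^ m * L ^ k))
    (reD M (L ^ k) ν) (reD_single M (L ^ k) ν) (reD M (L ^ m * L ^ k) ν) (reD_single M (L ^ m * L ^ k) ν)
    (rweight_nonneg (d := d) L k)
    (wTranspose M (L ^ k) (rweight (d := d) L k) (reD M (L ^ k) ν)) (wTranspose_single M (L ^ k) (rweight (d := d) L k) (reD M (L ^ k) ν))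
    (wTranspose M (L ^ m * L ^ k) (rweight (d := d) L k / ((L : ℝ) ^ m) ^ (d + 1)) (reD M (L ^ m * L ^ k) ν))
    (wTranspose_single M (L ^ m * L ^ k) (rweight (d := d) L k / ((L : ℝ) ^ m) ^ (d + 1)) (reD M (L ^ m * L ^ k) ν))
    (covC L M (L ^ k)) (covC_single L M (L ^ k)) (covC L M (L ^ (k + m))) (covC_single L M (L ^ (k + m))) hρ hρ1
  refine key.mono fun y y' => ?_
  have hbal := card_mul_rweight (d := d) hL0 k
  have hcast : ((L ^ k : ℕ) : ℝ) = (L : ℝ) ^ k := by push_cast; ring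
  rw [hbal, hcast]
  have hE : 0 ≤ Real.exp (-(ρ * tdistT M y y')) := Real.exp_nonneg _
  refine mul_le_mul_of_nonneg_right ?_ hE
  have ht : 0 < ((L : ℝ) ^ k) ^ (-(min α γ / 2)) := Real.rpow_pos_of_pos (pow_pos (by exact_mod_cast (show 0 < L by omega)) _) _
  have hinv : ((L : ℝ) ^ k)⁻¹ ≤ ((L : ℝ) ^ k) ^ (-(min α γ / 2)) := inv_pow_le_rpow hL k hγ₀1
  have h₁ : (CGe (d + 1) + (d + 1) * MD163 (d + 1)) * periodConst (kappa163 (d + 1)) d / (L : ℝ) ^ k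
      ≤ (CGe (d + 1) + (d + 1) * MD163 (d + 1)) * periodConst (kappa163 (d + 1)) d * ((L : ℝ) ^ k) ^ (-(min α γ / 2)) := by
    rw [div_eq_mul_inv]
    exact mul_le_mul_of_nonneg_left hinv (by positivity)
  have h₂ : C₁ * ((L : ℝ) ^ k)⁻¹ ≤ C₁ * ((L : ℝ) ^ k) ^ (-(min α γ / 2)) := mul_le_mul_of_nonneg_left hinv hC₁.le
  have h₃ := rateD_le (d := d) hL k hα0 hα1 hγ0 hγ1
  exact (shape2_le (by positivity) hcD hcr0 hB₀.le (by positivity) h₁ h₂ h₃).trans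
    (mul_le_mul_of_nonneg_right (le_add_of_nonneg_right zero_le_one) ht.le)

end Majorants

/-! ## §3 Uniform constants over the three entries and all directions -/

section Uniform

variable {L : ℕ} [NeZero L]

omit [NeZero L] in
/-- Finite uniformisation: direction-wise constants `(B_ν, δ_ν)` of a property monotone in `B` (up) and `δ` (down) give ONE pair for all
`d + 1` directions (`B = Σ_ν B_ν`, `δ = min_ν δ_ν`). [folklore] -/
theorem exists_forall_fin_of_forall_exists {n : ℕ} (P : Fin (n + 1) → ℝ → ℝ → Prop)
    (hmono : ∀ ν B δ B' δ', B ≤ B' → δ' ≤ δ → P ν B δ → P ν B' δ')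
    (h : ∀ ν, ∃ B δ : ℝ, 0 < B ∧ 0 < δ ∧ P ν B δ) :
    ∃ B δ : ℝ, 0 < B ∧ 0 < δ ∧ ∀ ν, P ν B δ := by
  choose B δ hB hδ hP using h
  refine ⟨∑ ν, B ν, Finset.univ.inf' Finset.univ_nonempty δ, Finset.sum_pos (fun ν _ => hB ν) Finset.univ_nonempty,
    (Finset.lt_inf'_iff _).mpr fun ν _ => hδ ν, fun ν => hmono ν _ _ _ _ ?_ ?_ (hP ν)⟩
  · exact Finset.single_le_sum (fun ν _ => (hB ν).le) (Finset.mem_univ ν)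
  · exact Finset.inf'_le _ (Finset.mem_univ ν)

/-- **THE THREE PROVED (3.42) ENTRIES WITH ONE SET OF CONSTANTS.**  For `d + 1 ≥ 2`, `L ≥ 1`, `0 ≤ α < 1`, `0 < γ < 1` there are `B, δ₀ > 0` such
that for EVERY unit torus `Π ℤ∕M_ν` with `L ∣ M_ν`, all levels `k`, `m ≥ 1` and every direction `ν`, each of `𝔇(G′, G)`, `𝔇(∂′_νG′, ∂_νG)`,
`𝔇(G′∂′_ν*, G∂_ν*)` for the vector single-scale piece `G = H_kC^{(k)}(η^{d+1}H_kᵀ)` has the block majorant `B·(L^k)^{−min(α,γ)∕2}·e^{−δ₀|y−y′|_T}`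
between the sharp cube norms of the fine-bond assignments (King's pairing).  Every analytic input is a tree theorem of parts 8–14 (this seat) over
the b05∕t4-ne2∕(2.156) lineages; nothing printed is a hypothesis. [cite: Balaban1985BackgroundPropagators, (3.42) p.397 (the three entries, shape); King1986, (4.42)–(4.43) p.675; Balaban1984PropagatorsI, (1.63) p.28; Balaban1984PropagatorsII, (2.156) p.250] -/
theorem hasMaj_threeEntries (hd : 1 ≤ d) (hL : 1 ≤ L) {α γ : ℝ} (hα0 : 0 ≤ α) (hα1 : α < 1) (hγ0 : 0 < γ) (hγ1 : γ < 1) :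
    ∃ B δ₀ : ℝ, 0 < B ∧ 0 < δ₀ ∧ ∀ (M : Fin (d + 1) → ℕ) [∀ μ, NeZero (M μ)] (_ : ∀ i, L ∣ M i) (k m : ℕ) (_ : 1 ≤ m) (ν : Fin (d + 1)),
      HasMaj (BlockNorm.ofBlocks (unitTorusGeo L k M) (blkFine L k M))
          (BlockNorm.ofBlocks (unitTorusGeo L k M) (blkFine L k M ∘ kingPrV L k m M))
          (entry0 (d := d) L k m M) (fun y y' => B * ((L : ℝ) ^ k) ^ (-(min α γ / 2)) * Real.exp (-(δ₀ * tdistT M y y')))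
      ∧ HasMaj (BlockNorm.ofBlocks (unitTorusGeo L k M) (blkFine L k M))
          (BlockNorm.ofBlocks (unitTorusGeo L k M) (blkFine L k M ∘ kingPrV L k m M))
          (entry1 (d := d) L k m M ν) (fun y y' => B * ((L : ℝ) ^ k) ^ (-(min α γ / 2)) * Real.exp (-(δ₀ * tdistT M y y')))
      ∧ HasMaj (BlockNorm.ofBlocks (unitTorusGeo L k M) (blkFine L k M))
          (BlockNorm.ofBlocks (unitTorusGeo L k M) (blkFine L k M ∘ kingPrV L k m M))
          (entry2 (d := d) L k m M ν) (fun y y' => B * ((L : ℝ) ^ k) ^ (-(min α γ / 2)) * Real.exp (-(δ₀ * tdistT M y y'))) := by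
  have hγ₀1 : min α γ / 2 ≤ 1 := by
    have := min_le_left α γ; linarith
  -- the shape `P ν B δ` of the direction-wise statements, monotone in `(B, δ)`
  let P : Fin (d + 1) → ℝ → ℝ → Prop := fun ν B δ => ∀ (M : Fin (d + 1) → ℕ) [∀ μ, NeZero (M μ)] (_ : ∀ i, L ∣ M i)
      (k m : ℕ) (_ : 1 ≤ m) {ρ : ℝ} (_ : 0 ≤ ρ) (_ : ρ ≤ δ),
      HasMaj (BlockNorm.ofBlocks (unitTorusGeo L k M) (blkFine L k M))
          (BlockNorm.ofBlocks (unitTorusGeo L k M) (blkFine L k M ∘ kingPrV L k m M))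
          (entry1 (d := d) L k m M ν) (fun y y' => B * ((L : ℝ) ^ k) ^ (-(min α γ / 2)) * Real.exp (-(ρ * tdistT M y y')))
      ∧ HasMaj (BlockNorm.ofBlocks (unitTorusGeo L k M) (blkFine L k M))
          (BlockNorm.ofBlocks (unitTorusGeo L k M) (blkFine L k M ∘ kingPrV L k m M))
          (entry2 (d := d) L k m M ν) (fun y y' => B * ((L : ℝ) ^ k) ^ (-(min α γ / 2)) * Real.exp (-(ρ * tdistT M y y')))
  have hP : ∀ ν, ∃ B δ : ℝ, 0 < B ∧ 0 < δ ∧ P ν B δ := by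
    intro ν
    obtain ⟨B₁, δ₁, hB₁, hδ₁, H₁⟩ := hasMaj_entry1 (d := d) hd hL hα0 hα1 hγ0 hγ1 ν
    obtain ⟨B₂, δ₂, hB₂, hδ₂, H₂⟩ := hasMaj_entry2 (d := d) hd hL hα0 hα1 hγ0 hγ1 ν
    refine ⟨max B₁ B₂, min δ₁ δ₂, lt_max_of_lt_left hB₁, lt_min hδ₁ hδ₂, fun M _ hLM k m hm ρ hρ hρ1 => ⟨?_, ?_⟩⟩
    · refine (H₁ M hLM k m hm hρ (hρ1.trans (min_le_left _ _))).mono fun y y' => ?_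
      exact mul_le_mul_of_nonneg_right (mul_le_mul_of_nonneg_right (le_max_left _ _) (Real.rpow_nonneg (by positivity) _))
        (Real.exp_nonneg _)
    · refine (H₂ M hLM k m hm hρ (hρ1.trans (min_le_right _ _))).mono fun y y' => ?_
      exact mul_le_mul_of_nonneg_right (mul_le_mul_of_nonneg_right (le_max_right _ _) (Real.rpow_nonneg (by positivity) _))
        (Real.exp_nonneg _)
  have hmono : ∀ ν B δ B' δ', B ≤ B' → δ' ≤ δ → P ν B δ → P ν B' δ' := by
    intro ν B δ B' δ' hBB' hδδ' h M _ hLM k m hm ρ hρ hρ1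
    obtain ⟨h₁, h₂⟩ := h M hLM k m hm hρ (hρ1.trans hδδ')
    exact ⟨h₁.mono fun y y' => mul_le_mul_of_nonneg_right (mul_le_mul_of_nonneg_right hBB' (Real.rpow_nonneg (by positivity) _))
        (Real.exp_nonneg _),
      h₂.mono fun y y' => mul_le_mul_of_nonneg_right (mul_le_mul_of_nonneg_right hBB' (Real.rpow_nonneg (by positivity) _))
        (Real.exp_nonneg _)⟩
  obtain ⟨B₁₂, δ₁₂, hB₁₂, hδ₁₂, H₁₂⟩ := exists_forall_fin_of_forall_exists P hmono hP
  obtain ⟨B₀, δ₀', hB₀, hδ₀', H₀⟩ := hasMaj_entry0 (d := d) hd hL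
  refine ⟨max B₀ B₁₂, min δ₀' δ₁₂, lt_max_of_lt_left hB₀, lt_min hδ₀' hδ₁₂, fun M _ hLM k m hm ν => ⟨?_, ?_⟩⟩
  · refine (H₀ M hLM k m hm (le_min hδ₀'.le hδ₁₂.le) (min_le_left _ _)).mono fun y y' => ?_
    exact mul_le_mul_of_nonneg_right (mul_le_mul (le_max_left _ _) (inv_pow_le_rpow hL k hγ₀1) (by positivity) (by positivity))
      (Real.exp_nonneg _)
  · obtain ⟨h₁, h₂⟩ := H₁₂ ν M hLM k m hm (le_min hδ₀'.le hδ₁₂.le) (min_le_right _ _)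
    exact ⟨h₁.mono fun y y' => mul_le_mul_of_nonneg_right (mul_le_mul_of_nonneg_right (le_max_right _ _)
        (Real.rpow_nonneg (by positivity) _)) (Real.exp_nonneg _),
      h₂.mono fun y y' => mul_le_mul_of_nonneg_right (mul_le_mul_of_nonneg_right (le_max_right _ _)
        (Real.rpow_nonneg (by positivity) _)) (Real.exp_nonneg _)⟩

end Uniform

end Summit.QuantumFields.YangMills.BalabanUVNodes.N15.VectorPiece
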